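import Summits.BirchSwinnertonDyer.BirchSwinnertonDyer.Theses.ManinLocalTwoThree
import Summits.BirchSwinnertonDyer.BirchSwinnertonDyer.Theorems.ManinLocalTwoThreeManinPrimeToAdditiveFiveLeOptimalPartner
import Summits.BirchSwinnertonDyer.BirchSwinnertonDyer.Theorems.ManinLocalTwoThreeManinPrimeToAdditiveFiveLeKatoReductionFiveLe
import Summits.BirchSwinnertonDyer.BirchSwinnertonDyer.Theorems.ManinLocalTwoThreeManinPrimeToAdditiveFiveLeReducibleResidueSharp
import Summits.BirchSwinnertonDyer.BirchSwinnertonDyer.Theorems.ManinLocalTwoThreeManinPrimeToAdditiveFiveLeReducibleResidueThirteenStub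
import Summits.BirchSwinnertonDyer.BirchSwinnertonDyer.Theorems.ManinLocalTwoThreeManinPrimeToAdditiveFiveLeReducibleThirteenDegreeUp
import Summits.BirchSwinnertonDyer.BirchSwinnertonDyer.Theorems.ManinLocalTwoThreeManinPrimeToAdditiveFiveLeRedFiveSevenSharpSplit
import Summits.BirchSwinnertonDyer.BirchSwinnertonDyer.Theorems.ManinLocalTwoThreeManinPrimeToAdditiveFiveLeRedFiveTypeIIFlipTwin
import Summits.BirchSwinnertonDyer.BirchSwinnertonDyer.Theorems.ManinLocalTwoThreeManinPrimeToAdditiveFiveLeBistarredGord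
import Summits.BirchSwinnertonDyer.BirchSwinnertonDyer.Theorems.ManinLocalTwoThreeManinPrimeToAdditiveFiveLeTypeIIAtFiveCornerOfUnstarredLaw
import Summits.BirchSwinnertonDyer.BirchSwinnertonDyer.Theorems.ManinLocalTwoThreeManinPrimeToAdditiveFiveLeRedFiveSevenCells
import Literature.NumberTheory.EllipticCurves.IsogenyNeronScalarPotSupersingular
import HarnessLib

/-!
# Crux `ManinPrimeToAdditiveFiveLe` (stmt-BirchSwinnertonDyer-22969) — line `etale-eisenstein`
# (ideator bsd-idea-8 gen 5, lens «nearmiss», 2026-08-28): THE POTENTIALLY ORDINARY REDUCIBLE CELLS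
# RIDE THE ÉTALE END OF THE OPTIMAL CURVE'S RATIONAL `p`-KERNEL (a re-cut of the lead's v9 skeleton)

rev 2 (2026-08-28, after critic V#42 PASS-WITH-PRICE): H1 `def EtaleEnd` carries its own pinning hypothesis; H2 rung count
stated; prices P1 (quotes memo `Lines/etale-eisenstein-quotes.md`) and P2 (runnable falsifier = kit ask, same memo §P2) paid
alongside; no statement of any stub changed except through the def (E and O are WEAKER by one discharged hypothesis).

PUBLISH-ONLY birth skeleton (W-79: the lead `prover-bsd-line-ml23-c5-p1` holds the line of record
`Lines/upper_anchor.lean` v9, sha16 15e8acc5ed72aae0; this file is NOT registered by its author). It is the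
v9 skeleton VERBATIM except that the two potentially ORDINARY `W[p]`-reducible cell stubs of v9 —
`stub_red7ordIV` (cell `(7; IV)`, tame index `e = 3`) and `stub_red57corner` (Kummer corners `(5; III)`,
`(7; II)`, `e = p − 1`) — are THEOREMS (`red7ordIV_of_etaleEnd`, `red57corner_of_etaleEnd`) modulo two
NEW stubs cut along Edixhoven's own near-miss (1991 §4, case 1 «not excluded», `v_p(c) ≤ 1`):

* `stub_etaleEnd57` — the **étale-end law** (Manin-free, degree-free): the lattice-optimal curve `W` on the
  reducible additive locus at `p ∈ {5, 7}` is the ÉTALE (= lower-Faltings-height) end of every cyclic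
  `p`-isogeny out of it: in the lattice form of the tree fact
  `gealyKlagsbrun2017_neronScalar_of_additive_potSupersingular`, `α·Λ_W ⊆ Λ_{W₂}` of index `p` forces
  `p ∤ α` (`def EtaleEnd`). Census (HOME data/FHEIGHT-rows-v1, kit j290304, every prime-degree isogeny out
  of an `X₀(N)`-optimal curve, `N < 5·10⁵`): additive `p = 5`: 3 194 / 3 194 edges `k = −1` (optimal LOWER),
  `p = 7`: 637 / 637, `p ≥ 11`: 199 / 199 — 0 exceptions; it is the LEVEL-EDGE clause (lattice reading) of
  the cell bsd-f2-manin's typed law `RootEdgeGainOnlyByDrop p` (E-imc-12, `IsogenyEdgeLaws.lean`, 564 312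
  root edges, 0 violations, refuter-graded NOT-IN-PRINT / TABLE-TRUE). Nearest print: Stevens 1989 Conj. II,
  Vatsal 2005 Thms 1.10–1.11 (semistable / ordinary `ℓ ≥ 7`), which do not reach an additive `p`.
  REMARK (not folded, stubs_max): on the potentially SUPERSINGULAR reducible cells the same law implies the
  lead's law (U) `stub_optimalUnstarredNonGord57` outright, by the tree fact (Gealy–Klagsbrun 2017 Thm 1:
  the `p`-isogeny out of the STARRED member of a flip pair has Néron scalar `p ∥ α`) — one law, not two.
* `stub_potOrdRed57_of_etaleEnd` — **Manin on the three potentially ordinary reducible cells GIVEN the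
  étale end.** The lever (ideator's ★★, Raynaud-free, hence valid at the Kummer corners `e = p − 1` where
  Edixhoven's Prop. 7 is void): over Edixhoven's `U = W(𝔽̄_p)[p^{1/n}]`, `n = (p² − 1)/2`, with `ℰ_U` the
  (good, ORDINARY) model of `W` and `P ∈ ℰ_u[p](𝔽̄_p)` the physical point of order `p`, one has
  «`φ^*_u(P) = 0` in `Pic⁰(X̃_{U,u})` ⟺ `φ|_D` is inseparable or constant on EVERY component `D` of the
  stable fibre» (⇐: `F^* = V` kills physical `p`-torsion; ⇒: a separable `φ|_D = α ∘ h` with `h` minimal has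
  `ker α^*` = Cartier dual of an étale group, connected, and `h^*` injective). So Edixhoven's case 1 is
  EXACTLY the collapse in `𝒥₀(N) ⊗ U` of the reduction of `P`; and when `W` is the étale end of its rational
  `p`-isogeny `W → W/C` (hypothesis `EtaleEnd`, with Dokchitser–Dokchitser 2015 Thm 5.1 (1): the isogeny
  preserves `v_p Δ_min` on potentially ordinary cells, so `ℰ_U → ℰ'_U` is étale and `C(ℚ̄) = C(K_U)`
  reduces onto `⟨P⟩`), case 1 ⟺ «the rational EISENSTEIN line `ι(C) ⊂ J₀(N)[p]` (`ι = φ^*`, `C ≅ 𝔽_p(χ₁)`,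
  annihilated by the Eisenstein ideal of `ρ̄_W^{ss} = χ₁ ⊕ ωχ₁⁻¹`) dies in the Néron model of `J₀(N)`
  over `U`». Case 2 ⟹ `p ∤ c` is Edixhoven §4 (Props 5–6 and the order-of-vanishing count; Prop. 7 is
  not used on this branch). OPEN CONTENT = NON-COLLAPSE of `ι(C)`: by Prop. 6 `φ` lives on the two CENTRAL
  (IGUSA) components `Ig(p)/±1 ×_{X(1)} X₀(M)` (Edixhoven 1990 AIF p. 34: `(p−1)/2`-th root of the Hasse
  invariant, KM 12.8.2), inertia `μ_n` acts on `ι(P)_u` through `χ₁|_{I_p} = ω^{∓(p−1)/e}`, so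
  `ι(P)_u ∈ Jac(Igusa components)(𝔽̄_p)[p]^{(ω^{∓(p−1)/e})}` — the Igusa-tower eigenspaces of Mazur–Wiles
  1983 («Analogies») — and by Serre's Cartier dictionary `ι(P)_u ≠ 0` ⟺ the logarithmic differential
  `φ|_D^* ω_{ℰ_u}` is a NON-ZERO ordinary mod-`p` cusp form of weight `2 + (p−1)/e`-type and level `M` with
  the Eisenstein eigenvalues of `ρ̄_W`; if `ι(C)` lies in the cuspidal group, non-collapse is a universal,
  `W`-free statement about the specialised `χ₁`-cuspidal divisor on the Igusa component. Census: the three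
  cells carry 377 + 112 + 43 commuting orbits (`N ≤ 5·10⁵`), all `c = 1`, i.e. non-collapse holds in range.

Stubs (7 = stubs_max): `stub_printedInputs` (7 cite-only facts, NOT a prover target), `stub_kp57`
(stmt-23810 BY NAME), `stub_red57ss` (v9 verbatim: potentially supersingular cells `(5; IV)`, `(7; III)`),
`stub_etaleEnd57` (NEW), `stub_potOrdRed57_of_etaleEnd` (NEW), `stub_optimalUnstarredNonGord57` (law (U),
v8 verbatim), `stub_degreeUp13Red` (v5 verbatim). THEOREMS inside: `red7ordIV_of_etaleEnd`,
`red57corner_of_etaleEnd` (gen 5, trivial compositions), `red57unstarredOffIIAtFive_of_cells` (lead gen 5,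
p625709), `typeIIAtFiveCorner_of_unstarredLaw` (μ), `red57bistarred_of_dokchitser_of_unstarredLaw` (λ_w2),
`red57unstarred_of_flipTwin` (λ_lead), `red57sharp_of_split` (θ), `red13sharp_of_degreeUp13Red`, composition
`ManinPrimeToAdditiveFiveLe_of` concluding the crux BY NAME (sorry-free outside the stubs). HONEST SCOPE: C5
is NOT proved; the non-collapse statement is open (no printed anchor on the additive Eisenstein locus:
presearch corpus fts + vec + galaxy, gens 4–5); registering/publishing a skeleton books nothing; BSD is not
proved by any of this. The v9 card of the lead follows verbatim for the unchanged stubs.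
-/

/-! ## History (v1–v3, ideator bsd-idea-8 + lead gen 0/1) — pointer

The original line card («upper anchor»: Edixhoven 1991 Thm. 3 as near-miss; the an-cell's PROVED near-invariance
`pStar_optimal_commuting_manin_near_invariance` closing C5 from an UPPER ANCHOR on the starred member of a commuting
optimal `χ_{p*}`-pair plus a DIRECTION LAW; stubs `stub_optimalPartner` [PROVED p606476], `stub_upperAnchor`,
`stub_directionLawIrr`, `stub_reducibleTwistMinimal`, all closed MODULO named facts by gens 1–2) is kept verbatim in
the tree history of this file (commit eb90aa6b1e0b, skeleton v6) and in `Cruxes/…/LEDGER-upper-anchor.md`.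
-/

set_option autoImplicit false
set_option linter.dupNamespace false

noncomputable section

open scoped NumberField

open WeierstrassCurve IsDedekindDomain NumberField Literature.NumberTheory.EllipticCurves
  Literature.NumberTheory.EllipticCurves.ModularForms
  Summit.BirchSwinnertonDyer.Rank1Residual.ManinAdditive
  Summit.BirchSwinnertonDyer.BirchSwinnertonDyer.Theses.EdixhovenFibreFiveSeven
  Summit.BirchSwinnertonDyer.BirchSwinnertonDyer.Theorems

namespace Summit.BirchSwinnertonDyer.BirchSwinnertonDyer.Cruxes.ManinPrimeToAdditiveFiveLe.EtaleEisenstein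

/-- v3 STUB 1 — CLOSED (p606476, width seat): the commuting optimal `p*`-partner. Kept for the record;
not used by the v4 composition. [cite: Watkins2002, §2.1] -/
theorem stub_optimalPartner :
    exists_isNewformOf →
    ∀ {p : ℕ}, p.Prime → 5 ≤ p →
    ∀ (W : WeierstrassCurve ℚ) [W.IsElliptic] [W.IsGloballyMinimal] [NeZero (W.conductorNorm ℤ)]
      (D : ModularParametrizationData W (W.conductorNorm ℤ)),
      IsLatticeOptimal D → p ^ 2 ∣ W.conductorNorm ℤ →
      ¬ (∃ (W' : WeierstrassCurve ℚ), W'.IsElliptic ∧ W'.IsGloballyMinimal ∧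
          IsIsogenous W (W'.quadraticTwist (((-1 : ℤ) ^ (p / 2) * p : ℤ) : ℚ)) ∧
          ¬ p ^ 2 ∣ W'.conductorNorm ℤ) →
      W.HasIrreducibleModPGaloisRep p →
      ∃ (W' : WeierstrassCurve ℚ) (_ : W'.IsElliptic) (_ : W'.IsGloballyMinimal)
        (_ : NeZero (W'.conductorNorm ℤ)) (u : VariableChange ℚ)
        (D' : ModularParametrizationData W' (W'.conductorNorm ℤ)),
        IsLatticeOptimal D' ∧ W'.conductorNorm ℤ = W.conductorNorm ℤ ∧
        u • W.quadraticTwist ((((-1 : ℤ) ^ (p / 2) * p : ℤ)) : ℚ) = W' :=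
  -- CLOSED (width seat -w2, p606476): tree theorem, verbatim signature
  Summit.BirchSwinnertonDyer.BirchSwinnertonDyer.Theorems.stub_optimalPartner

/-- STUB P — **the printed inputs** (SEVEN cite-only Literature facts as ONE conjunction — v8 adds Dokchitser–Dokchitser
2015 Thm. 5.1 (1) `dokchitser_padicValInt_minimalDiscriminantInt_eq_of_isogeny_of_potentiallyGoodOrdinary` as conjunct 7
[cite: DokchitserDokchitser2015LocalInvariants, Thm. 5.1 (1)]; NOT a prover target —
each conjunct is a statement-only `def … : Prop` that closes only by an XL `_holds` port under `Literature/`):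
Kato F″ `kato_neron_isIntegral_twistedSymbolSum_of_additive_five_le` (Kato (8.1.3)/9.7/6.6 + Kim–Nakamura 2.4 +
Kosters–Pannekoek Thm 1, derived reading), ČNS Thm 1.2, Cremona's table `N ≤ 5·10⁵`, Edixhoven 1991 Thm 3
(Kodaira half, ordinarity half), Mazur 1978 Thm 1 with the rational points of `X₀(p)`.
[cite: Kato2004Asterisque, (8.1.3) (p. 180), Thm. 9.7 (p. 189)] [cite: CesnaviciusNeururerSaha2023, Thm. 1.2]
[cite: EdixhovenManin1991, Thm. 3] [cite: Mazur1978, Thm. 1] -/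
theorem stub_printedInputs :
    kato_neron_isIntegral_twistedSymbolSum_of_additive_five_le ∧
    cesnaviciusNeururerSaha_padicVal_maninConstant_le_modularDegree ∧
    cremona_abs_maninConstant_eq_one_of_level_le_500000 ∧
    edixhoven_not_dvd_maninConstant_of_kodairaSymbol_ne ∧
    edixhoven_not_dvd_maninConstant_of_not_potentiallyGoodOrdinary ∧
    mazur_j_mem_of_not_hasIrreducibleModPGaloisRep_of_eleven_le ∧
    dokchitser_padicValInt_minimalDiscriminantInt_eq_of_isogeny_of_potentiallyGoodOrdinary := by
  sorry

/-- STUB K — **crux KP57 BY NAME** (`EdixhovenFibreFiveSeven.KPResidueManinUnitFiveSeven`,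
stmt-BirchSwinnertonDyer-23810, route `EdixhovenFibreFiveSeven`, cell `pub/bsd-wall`): `p ∈ {5,7}`, `W[p]`
irreducible, additive with a `ℚ_p`-rational point of order `p` (Kosters–Pannekoek exceptional fibre), `p ∣` every
conductor-level degree, `N > 5·10⁵` ⟹ some conductor-level datum has `p ∤ c`. OPEN; owned there.
[cite: KostersPannekoek2017, Cor. 2] [cite: EdixhovenManin1991, Thm. 3] -/
theorem stub_kp57 : KPResidueManinUnitFiveSeven := by
  sorry

/-- STUB R57-SS (v9) — **the potentially SUPERSINGULAR Raynaud-admissible cells `(5; IV)`, `(7; III)`**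
(hypothesis `hSS` of the lead's `coreRED57unstarredOffII5_of_cells`, gen 5, VERBATIM): the v8 anchor stub — rational
`p`-isogeny, `p² ∣ N(W) > 5·10⁵`, globally twist-minimal, `p ∣ deg φ`, no `Iₙ*` fibre, `ord_p Δ_min(W) ≤ 4`, off
`(5; II)`, lattice-optimal conductor-level datum ⟹ `p ∤ c(D)` — restricted to `(p; ord_p Δ_min) ∈ {(5;4), (7;3)}`.
Tame index `e = 3` resp. `4`: `e < p − 1` (Raynaud's hypothesis of Edixhoven's Prop. 7 HOLDS) and `e ∤ p − 1`
(potentially supersingular; `¬ TypeGOrd W p` is PROVED: `not_typeGOrd_of_red57ssCell`). OPEN; printed MECHANISM: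
Edixhoven 1991 Props 5–8 + the parity argument for potentially supersingular reduction give `p ∤ c` verbatim once
«`p > 7`» is read as «`e < p − 1`» (XL port of the stable model of `X₀(p²M)`). Census `N ≤ 5·10⁵`: 771 (at 5) + 122
(at 7) classes, all flip orbits, all `c = 1`. [cite: EdixhovenManin1991, Props. 7–8 and §4] [cite: SerreTate1968, §2 Cor. 3] -/
theorem stub_red57ss :
    mazur_not_dvd_maninConstant_of_odd → abbesUllmo_not_dvd_maninConstant_of_not_dvd_level →
    cesnavicius_not_two_dvd_maninConstant_of_two_dvd_level → exists_isNewformOf →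
    ∀ (W : WeierstrassCurve ℚ) [W.IsElliptic] [W.IsGloballyMinimal] [NeZero (W.conductorNorm ℤ)]
      (D : ModularParametrizationData W (W.conductorNorm ℤ)),
      IsLatticeOptimal D → ∀ (p : ℕ) (hp : p.Prime), (p = 5 ∨ p = 7) → p ^ 2 ∣ W.conductorNorm ℤ →
      ¬ (∃ (W' : WeierstrassCurve ℚ) (q : ℕ), W'.IsElliptic ∧ W'.IsGloballyMinimal ∧ q.Prime ∧
          q ≠ 2 ∧ q ^ 2 ∣ W.conductorNorm ℤ ∧
          IsIsogenous W (W'.quadraticTwist (((-1 : ℤ) ^ (q / 2) * q : ℤ) : ℚ)) ∧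
          ¬ q ^ 2 ∣ W'.conductorNorm ℤ) →
      ¬ (∃ (W' : WeierstrassCurve ℚ) (d : ℤ), W'.IsElliptic ∧ W'.IsGloballyMinimal ∧
          (d = -1 ∨ d = 2 ∨ d = -2) ∧ 2 ^ 2 ∣ W.conductorNorm ℤ ∧
          IsIsogenous W (W'.quadraticTwist (d : ℚ)) ∧ ¬ 2 ^ 2 ∣ W'.conductorNorm ℤ) →
      ¬ W.HasIrreducibleModPGaloisRep p →
      500000 < W.conductorNorm ℤ →
      p ∣ D.modularDegree →
      (∀ n : ℕ, W.kodairaSymbolAt ((Rat.HeightOneSpectrum.primesEquiv (R := ℤ)).symm ⟨p, hp⟩) ≠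
        .Istar n) →
      padicValInt p W.minimalDiscriminantInt ≤ 4 →
      (p = 5 → padicValInt p W.minimalDiscriminantInt ≠ 2) →
      ((p = 5 ∧ padicValInt p W.minimalDiscriminantInt = 4) ∨
        (p = 7 ∧ padicValInt p W.minimalDiscriminantInt = 3)) →
      ¬ (p : ℤ) ∣ D.maninConstant := by
  sorry

/-- `W` (with Néron period pair `L`) is the **étale end** of every cyclic `p`-isogeny out of it, in the
lattice form of the tree fact `gealyKlagsbrun2017_neronScalar_of_additive_potSupersingular`: whenever
`α · Λ_W ⊆ Λ_{W₂}` with index `p` for a globally minimal `W₂` with Néron period pair `L₂` (the isogeny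
`z ↦ α z : ℂ/Λ_W → ℂ/Λ_{W₂}` pulls the Néron differential of `W₂` back to `α · ω_W`), the Néron scalar
`α` is prime to `p` (`α = ±1`, not `± p`): the kernel is étale at `p`, `W` is the lower-Faltings-height end.
rev 2 (critic V#42 H1): the pinning `IsNeronLatticeOf (W.baseChange ℂ) L` is a hypothesis INSIDE the def, so `EtaleEnd W L p`
no longer leans on `D` to pin `L` (for `L = D.L` it is discharged by `D.isNeronLattice`). -/
def EtaleEnd (W : WeierstrassCurve ℚ) (L : PeriodPair) (p : ℕ) : Prop :=
  IsNeronLatticeOf (W.baseChange ℂ) L →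
  ∀ (W₂ : WeierstrassCurve ℚ) [W₂.IsElliptic] [W₂.IsGloballyMinimal] (L₂ : PeriodPair) (α : ℤ),
    IsNeronLatticeOf (W₂.baseChange ℂ) L₂ →
    (∀ z ∈ L.lattice, (α : ℂ) * z ∈ L₂.lattice) →
    (L.lattice.toAddSubgroup.map (AddMonoidHom.mulLeft (α : ℂ))).relIndex L₂.lattice.toAddSubgroup = p →
    ¬ (p : ℤ) ∣ α

/-- STUB E (NEW, gen 5) — **the étale-end law at `p ∈ {5, 7}`** (Manin-free, degree-free): a globally
minimal `W` with a LATTICE-OPTIMAL conductor-level datum `D`, `p² ∣ N(W) > 5·10⁵`, globally twist-minimal,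
`W[p]` reducible, no `Iₙ*` fibre at `p`, is the ÉTALE end of every cyclic `p`-isogeny out of it
(`EtaleEnd W D.L p`: `α·Λ_W ⊆ Λ_{W₂}` of index `p` ⟹ `p ∤ α`; equivalently `W` is the lower-Faltings-height
end, the kernel is étale at `p`, the Manin `p`-part does not grow along the edge). Census `N < 5·10⁵`
(HOME data/FHEIGHT-rows-v1): 3 194 / 3 194 (additive `p = 5`) + 637 / 637 (`p = 7`) prime-degree edges out of
the optimal curve have `k = −1` — THE RUNG of this stub is these 3 831 = 3 194 + 637 edges at `p ∈ {5, 7}` (the further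
199 / 199 at `p ≥ 11` lie outside this stub's range and are quoted for context only; V#42 H2); = the level-edge clause of the
typed tree law `RootEdgeGainOnlyByDrop p` (E-imc-12, cell bsd-f2-manin; 0 / 564 312 violations; NOT in print). Why it might fail: a potentially
ordinary edge at the Kummer corner `(p, e) = (5, 4)` or `(7, 6)`, where inertia does not forbid `μ_p ⊂ W`
(1 459 + 429 such edges in range, 0 failures), beyond `5·10⁵`. OPEN (Stevens-type minimality; Stevens 1989
Conj. II + Vatsal 2005 Thms 1.10–1.11 cover semistable / ordinary `ℓ ≥ 7` only).
[cite: Stevens1989, §2] [cite: GealyKlagsbrun2017, Thm. 1] [cite: DokchitserDokchitser2015LocalInvariants, Table 1, Lemma 12] -/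
theorem stub_etaleEnd57 :
    exists_isNewformOf →
    ∀ (W : WeierstrassCurve ℚ) [W.IsElliptic] [W.IsGloballyMinimal] [NeZero (W.conductorNorm ℤ)]
      (D : ModularParametrizationData W (W.conductorNorm ℤ)),
      IsLatticeOptimal D → ∀ (p : ℕ) (hp : p.Prime), (p = 5 ∨ p = 7) → p ^ 2 ∣ W.conductorNorm ℤ →
      ¬ (∃ (W' : WeierstrassCurve ℚ) (q : ℕ), W'.IsElliptic ∧ W'.IsGloballyMinimal ∧ q.Prime ∧
          q ≠ 2 ∧ q ^ 2 ∣ W.conductorNorm ℤ ∧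
          IsIsogenous W (W'.quadraticTwist (((-1 : ℤ) ^ (q / 2) * q : ℤ) : ℚ)) ∧
          ¬ q ^ 2 ∣ W'.conductorNorm ℤ) →
      ¬ (∃ (W' : WeierstrassCurve ℚ) (d : ℤ), W'.IsElliptic ∧ W'.IsGloballyMinimal ∧
          (d = -1 ∨ d = 2 ∨ d = -2) ∧ 2 ^ 2 ∣ W.conductorNorm ℤ ∧
          IsIsogenous W (W'.quadraticTwist (d : ℚ)) ∧ ¬ 2 ^ 2 ∣ W'.conductorNorm ℤ) →
      ¬ W.HasIrreducibleModPGaloisRep p →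
      500000 < W.conductorNorm ℤ →
      (∀ n : ℕ, W.kodairaSymbolAt ((Rat.HeightOneSpectrum.primesEquiv (R := ℤ)).symm ⟨p, hp⟩) ≠
        .Istar n) →
      EtaleEnd W D.L p := by
  sorry

/-- STUB O (NEW, gen 5) — **Manin's `p ∤ c(D)` on the three potentially ORDINARY `W[p]`-reducible cells
`(p; ord_p Δ_min) ∈ {(5;3), (7;2), (7;4)}` (Kodaira `(5; III)`, `(7; II)`, `(7; IV)`; tame index `e = 4, 6, 3`,
`e ∣ p − 1`) GIVEN THE ÉTALE END** — the common hypothesis block of the lead's v9 cell stubs VERBATIM, plus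
`EtaleEnd W D.L p`. Mechanism (★★, Raynaud-free, so valid at the Kummer corners where Edixhoven's Prop. 7 is
void): with `ℰ_U` the good ordinary model of `W` over `U = W(𝔽̄_p)[p^{1/n}]` and `P ∈ ℰ_u[p](𝔽̄_p)` the
physical point of order `p`, `φ^*_u(P) = 0` in `Pic⁰(X̃_{U,u})` ⟺ `φ|_D` inseparable-or-constant on every
component — Edixhoven's case 1; by `EtaleEnd` (+ Dokchitser–Dokchitser 2015 Thm 5.1 (1), tree fact
`dokchitser_padicValInt_minimalDiscriminantInt_eq_of_isogeny_of_potentiallyGoodOrdinary`: the rational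
`p`-isogeny `W → W/C` preserves `v_p Δ_min` here, hence `ℰ_U → ℰ'_U` is étale and `C(ℚ̄) ⊂ W(K_U)` reduces
onto `⟨P⟩`), case 1 ⟺ the rational Eisenstein line `ι(C) ⊂ J₀(N)[p]` collapses in the Néron model of
`J₀(N)` over `U`; case 2 ⟹ `p ∤ c` (Edixhoven 1991 §4 with Props 5–6). OPEN CONTENT: non-collapse of
`ι(C)` — a position statement inside `Jac` of the two Igusa components of `X₀(p²M) ⊗ 𝔽̄_p` (Edixhoven 1990
AIF §2.3), in the `ω^{∓(p−1)/e}`-eigenspace of their physical `p`-torsion (Mazur–Wiles 1983 Igusa-tower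
eigenspaces; Serre's Cartier dictionary: ⟺ `φ|_D^*ω_{ℰ_u}` is a non-zero ordinary mod-`p` cusp form with the
Eisenstein eigenvalues of `ρ̄_W`). Why it might fail: an optimal `W` beyond `5·10⁵` on one of the three cells
whose `ι(C)` is of multiplicative type in `𝒥₀(N) ⊗ ℤ_p[ζ_p]` (a Vatsal-type «`E ∩ Σ_N ≠ 0`» configuration at
an additive `p`), which collapses over `U` and gives `c = p`. Census `N ≤ 5·10⁵`: 377 + 112 + 43 commuting
orbits on the three cells, all `c = 1`.
[cite: EdixhovenManin1991, Props. 5–7 and §4] [cite: DokchitserDokchitser2015LocalInvariants, Thm. 5.1 (1)] [cite: Vatsal2005, Rem. 1.8, Conj. 1.9] -/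
theorem stub_potOrdRed57_of_etaleEnd :
    mazur_not_dvd_maninConstant_of_odd → abbesUllmo_not_dvd_maninConstant_of_not_dvd_level →
    cesnavicius_not_two_dvd_maninConstant_of_two_dvd_level → exists_isNewformOf →
    ∀ (W : WeierstrassCurve ℚ) [W.IsElliptic] [W.IsGloballyMinimal] [NeZero (W.conductorNorm ℤ)]
      (D : ModularParametrizationData W (W.conductorNorm ℤ)),
      IsLatticeOptimal D → ∀ (p : ℕ) (hp : p.Prime), (p = 5 ∨ p = 7) → p ^ 2 ∣ W.conductorNorm ℤ →
      ¬ (∃ (W' : WeierstrassCurve ℚ) (q : ℕ), W'.IsElliptic ∧ W'.IsGloballyMinimal ∧ q.Prime ∧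
          q ≠ 2 ∧ q ^ 2 ∣ W.conductorNorm ℤ ∧
          IsIsogenous W (W'.quadraticTwist (((-1 : ℤ) ^ (q / 2) * q : ℤ) : ℚ)) ∧
          ¬ q ^ 2 ∣ W'.conductorNorm ℤ) →
      ¬ (∃ (W' : WeierstrassCurve ℚ) (d : ℤ), W'.IsElliptic ∧ W'.IsGloballyMinimal ∧
          (d = -1 ∨ d = 2 ∨ d = -2) ∧ 2 ^ 2 ∣ W.conductorNorm ℤ ∧
          IsIsogenous W (W'.quadraticTwist (d : ℚ)) ∧ ¬ 2 ^ 2 ∣ W'.conductorNorm ℤ) →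
      ¬ W.HasIrreducibleModPGaloisRep p →
      500000 < W.conductorNorm ℤ →
      p ∣ D.modularDegree →
      (∀ n : ℕ, W.kodairaSymbolAt ((Rat.HeightOneSpectrum.primesEquiv (R := ℤ)).symm ⟨p, hp⟩) ≠
        .Istar n) →
      padicValInt p W.minimalDiscriminantInt ≤ 4 →
      (p = 5 → padicValInt p W.minimalDiscriminantInt ≠ 2) →
      ((p = 5 ∧ padicValInt p W.minimalDiscriminantInt = 3) ∨
        (p = 7 ∧ padicValInt p W.minimalDiscriminantInt = 2) ∨
        (p = 7 ∧ padicValInt p W.minimalDiscriminantInt = 4)) →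
      EtaleEnd W D.L p →
      ¬ (p : ℤ) ∣ D.maninConstant := by
  sorry

/-- v9 STUB R7-ORD-IV — now a THEOREM modulo `stub_etaleEnd57` ∧ `stub_potOrdRed57_of_etaleEnd` (gen 5; the
lead's v9 statement VERBATIM, cell `(7; IV)`: `e = 3 < 6`, potentially ordinary, Edixhoven's case 1 open since
1991). [cite: EdixhovenManin1991, Thm. 3 and §4] -/
theorem red7ordIV_of_etaleEnd :
    mazur_not_dvd_maninConstant_of_odd → abbesUllmo_not_dvd_maninConstant_of_not_dvd_level →
    cesnavicius_not_two_dvd_maninConstant_of_two_dvd_level → exists_isNewformOf →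
    ∀ (W : WeierstrassCurve ℚ) [W.IsElliptic] [W.IsGloballyMinimal] [NeZero (W.conductorNorm ℤ)]
      (D : ModularParametrizationData W (W.conductorNorm ℤ)),
      IsLatticeOptimal D → ∀ (p : ℕ) (hp : p.Prime), (p = 5 ∨ p = 7) → p ^ 2 ∣ W.conductorNorm ℤ →
      ¬ (∃ (W' : WeierstrassCurve ℚ) (q : ℕ), W'.IsElliptic ∧ W'.IsGloballyMinimal ∧ q.Prime ∧
          q ≠ 2 ∧ q ^ 2 ∣ W.conductorNorm ℤ ∧
          IsIsogenous W (W'.quadraticTwist (((-1 : ℤ) ^ (q / 2) * q : ℤ) : ℚ)) ∧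
          ¬ q ^ 2 ∣ W'.conductorNorm ℤ) →
      ¬ (∃ (W' : WeierstrassCurve ℚ) (d : ℤ), W'.IsElliptic ∧ W'.IsGloballyMinimal ∧
          (d = -1 ∨ d = 2 ∨ d = -2) ∧ 2 ^ 2 ∣ W.conductorNorm ℤ ∧
          IsIsogenous W (W'.quadraticTwist (d : ℚ)) ∧ ¬ 2 ^ 2 ∣ W'.conductorNorm ℤ) →
      ¬ W.HasIrreducibleModPGaloisRep p →
      500000 < W.conductorNorm ℤ →
      p ∣ D.modularDegree →
      (∀ n : ℕ, W.kodairaSymbolAt ((Rat.HeightOneSpectrum.primesEquiv (R := ℤ)).symm ⟨p, hp⟩) ≠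
        .Istar n) →
      padicValInt p W.minimalDiscriminantInt ≤ 4 →
      (p = 5 → padicValInt p W.minimalDiscriminantInt ≠ 2) →
      p = 7 → padicValInt p W.minimalDiscriminantInt = 4 →
      ¬ (p : ℤ) ∣ D.maninConstant :=
  fun hM hAU hC hNf W _ _ _ D hopt p hp h57 hp2 hq h2 hirr hN hdeg hIstar hv4 hII5 h7 hv =>
    stub_potOrdRed57_of_etaleEnd hM hAU hC hNf W D hopt p hp h57 hp2 hq h2 hirr hN hdeg hIstar hv4 hII5
      (Or.inr (Or.inr ⟨h7, hv⟩)) (stub_etaleEnd57 hNf W D hopt p hp h57 hp2 hq h2 hirr hN hIstar)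

/-- v9 STUB R57-CORNER — now a THEOREM modulo `stub_etaleEnd57` ∧ `stub_potOrdRed57_of_etaleEnd` (gen 5;
the lead's v9 statement VERBATIM, Kummer corners `(5; III)`, `(7; II)`: `e = p − 1`, Raynaud-void, potentially
ordinary — ★★ does not use Edixhoven's Prop. 7). [cite: KostersPannekoek2017, Thm. 1] [cite: EdixhovenManin1991, §4] -/
theorem red57corner_of_etaleEnd :
    mazur_not_dvd_maninConstant_of_odd → abbesUllmo_not_dvd_maninConstant_of_not_dvd_level →
    cesnavicius_not_two_dvd_maninConstant_of_two_dvd_level → exists_isNewformOf →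
    ∀ (W : WeierstrassCurve ℚ) [W.IsElliptic] [W.IsGloballyMinimal] [NeZero (W.conductorNorm ℤ)]
      (D : ModularParametrizationData W (W.conductorNorm ℤ)),
      IsLatticeOptimal D → ∀ (p : ℕ) (hp : p.Prime), (p = 5 ∨ p = 7) → p ^ 2 ∣ W.conductorNorm ℤ →
      ¬ (∃ (W' : WeierstrassCurve ℚ) (q : ℕ), W'.IsElliptic ∧ W'.IsGloballyMinimal ∧ q.Prime ∧
          q ≠ 2 ∧ q ^ 2 ∣ W.conductorNorm ℤ ∧
          IsIsogenous W (W'.quadraticTwist (((-1 : ℤ) ^ (q / 2) * q : ℤ) : ℚ)) ∧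
          ¬ q ^ 2 ∣ W'.conductorNorm ℤ) →
      ¬ (∃ (W' : WeierstrassCurve ℚ) (d : ℤ), W'.IsElliptic ∧ W'.IsGloballyMinimal ∧
          (d = -1 ∨ d = 2 ∨ d = -2) ∧ 2 ^ 2 ∣ W.conductorNorm ℤ ∧
          IsIsogenous W (W'.quadraticTwist (d : ℚ)) ∧ ¬ 2 ^ 2 ∣ W'.conductorNorm ℤ) →
      ¬ W.HasIrreducibleModPGaloisRep p →
      500000 < W.conductorNorm ℤ →
      p ∣ D.modularDegree →
      (∀ n : ℕ, W.kodairaSymbolAt ((Rat.HeightOneSpectrum.primesEquiv (R := ℤ)).symm ⟨p, hp⟩) ≠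
        .Istar n) →
      padicValInt p W.minimalDiscriminantInt ≤ 4 →
      (p = 5 → padicValInt p W.minimalDiscriminantInt ≠ 2) →
      ((p = 5 ∧ padicValInt p W.minimalDiscriminantInt = 3) ∨
        (p = 7 ∧ padicValInt p W.minimalDiscriminantInt = 2)) →
      ¬ (p : ℤ) ∣ D.maninConstant :=
  fun hM hAU hC hNf W _ _ _ D hopt p hp h57 hp2 hq h2 hirr hN hdeg hIstar hv4 hII5 hcell =>
    stub_potOrdRed57_of_etaleEnd hM hAU hC hNf W D hopt p hp h57 hp2 hq h2 hirr hN hdeg hIstar hv4 hII5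
      (hcell.elim Or.inl (fun h => Or.inr (Or.inl h)))
      (stub_etaleEnd57 hNf W D hopt p hp h57 hp2 hq h2 hirr hN hIstar)

/-- v8 STUB R57-LOW-OFF-II5 — now a THEOREM modulo `stub_red57ss` (v9) and the gen-5 theorems `red7ordIV_of_etaleEnd`,
`red57corner_of_etaleEnd` (⟸ `stub_etaleEnd57` ∧ `stub_potOrdRed57_of_etaleEnd`), by the lead's `coreRED57unstarredOffII5_of_cells` (gen 5; the Ogg–Tate case split): the
`W[p]`-reducible UNSTARRED residue at `p ∈ {5, 7}` off the Kodaira-II cell at 5 (hypothesis `hA` of p622240, VERBATIM).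
Kept under its v8 statement for the composition. [cite: SilvermanATAEC1994, IV Table 4.1] [cite: EdixhovenManin1991, Thm. 3] -/
theorem red57unstarredOffIIAtFive_of_cells :
    mazur_not_dvd_maninConstant_of_odd → abbesUllmo_not_dvd_maninConstant_of_not_dvd_level →
    cesnavicius_not_two_dvd_maninConstant_of_two_dvd_level → exists_isNewformOf →
    ∀ (W : WeierstrassCurve ℚ) [W.IsElliptic] [W.IsGloballyMinimal] [NeZero (W.conductorNorm ℤ)]
      (D : ModularParametrizationData W (W.conductorNorm ℤ)),
      IsLatticeOptimal D → ∀ (p : ℕ) (hp : p.Prime), (p = 5 ∨ p = 7) → p ^ 2 ∣ W.conductorNorm ℤ →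
      ¬ (∃ (W' : WeierstrassCurve ℚ) (q : ℕ), W'.IsElliptic ∧ W'.IsGloballyMinimal ∧ q.Prime ∧
          q ≠ 2 ∧ q ^ 2 ∣ W.conductorNorm ℤ ∧
          IsIsogenous W (W'.quadraticTwist (((-1 : ℤ) ^ (q / 2) * q : ℤ) : ℚ)) ∧
          ¬ q ^ 2 ∣ W'.conductorNorm ℤ) →
      ¬ (∃ (W' : WeierstrassCurve ℚ) (d : ℤ), W'.IsElliptic ∧ W'.IsGloballyMinimal ∧
          (d = -1 ∨ d = 2 ∨ d = -2) ∧ 2 ^ 2 ∣ W.conductorNorm ℤ ∧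
          IsIsogenous W (W'.quadraticTwist (d : ℚ)) ∧ ¬ 2 ^ 2 ∣ W'.conductorNorm ℤ) →
      ¬ W.HasIrreducibleModPGaloisRep p →
      500000 < W.conductorNorm ℤ →
      p ∣ D.modularDegree →
      (∀ n : ℕ, W.kodairaSymbolAt ((Rat.HeightOneSpectrum.primesEquiv (R := ℤ)).symm ⟨p, hp⟩) ≠
        .Istar n) →
      padicValInt p W.minimalDiscriminantInt ≤ 4 →
      (p = 5 → padicValInt p W.minimalDiscriminantInt ≠ 2) →
      ¬ (p : ℤ) ∣ D.maninConstant :=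
  coreRED57unstarredOffII5_of_cells stub_red57ss red7ordIV_of_etaleEnd red57corner_of_etaleEnd

/-- STUB U — **law (U): «optimal ⟹ unstarred» on the potentially supersingular `W[p]`-reducible locus at `p ∈ {5, 7}`**
(Manin-free, degree-free; hypothesis `hU` of the lead's `cornerTypeIIAtFive_of_optimalUnstarredNonGord` (μ), VERBATIM;
= the width seat's `hU` of p621355 §2 without its `p ∣ deg φ` binder): for `W` globally minimal with a LATTICE-OPTIMAL
conductor-level datum, `p ∈ {5,7}`, `p² ∣ N(W) > 5·10⁵`, globally twist-minimal, `W[p]` reducible, no `Iₙ*` fibre at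
`p`, NOT (G)-ordinary at `p`: `ord_p Δ_min(W) ≤ 4`. Census N ≤ 5·10⁵: 0 exceptions (the optimal curve of every
potentially supersingular reducible class is its unstarred member: 771 + 771 flip rows at 5, 122 at 7). Conjecture-shaped
(Stevens-type minimality: the unstarred `p`-isogenous partner has the smaller Faltings height, Gealy–Klagsbrun 2017);
OPEN, beyond print (Stein–Watkins-type statements are proved only for semistable N: Byeon–Kim 2014 / Vatsal 2005).
[cite: Stevens1989, §2] [cite: GealyKlagsbrun2017, Thm. 1] -/
theorem stub_optimalUnstarredNonGord57 :
    exists_isNewformOf →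
    ∀ (W : WeierstrassCurve ℚ) [W.IsElliptic] [W.IsGloballyMinimal] [NeZero (W.conductorNorm ℤ)]
      (D : ModularParametrizationData W (W.conductorNorm ℤ)),
      IsLatticeOptimal D → ∀ (p : ℕ) (hp : p.Prime), (p = 5 ∨ p = 7) → p ^ 2 ∣ W.conductorNorm ℤ →
      ¬ (∃ (W' : WeierstrassCurve ℚ) (q : ℕ), W'.IsElliptic ∧ W'.IsGloballyMinimal ∧ q.Prime ∧
          q ≠ 2 ∧ q ^ 2 ∣ W.conductorNorm ℤ ∧
          IsIsogenous W (W'.quadraticTwist (((-1 : ℤ) ^ (q / 2) * q : ℤ) : ℚ)) ∧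
          ¬ q ^ 2 ∣ W'.conductorNorm ℤ) →
      ¬ (∃ (W' : WeierstrassCurve ℚ) (d : ℤ), W'.IsElliptic ∧ W'.IsGloballyMinimal ∧
          (d = -1 ∨ d = 2 ∨ d = -2) ∧ 2 ^ 2 ∣ W.conductorNorm ℤ ∧
          IsIsogenous W (W'.quadraticTwist (d : ℚ)) ∧ ¬ 2 ^ 2 ∣ W'.conductorNorm ℤ) →
      ¬ W.HasIrreducibleModPGaloisRep p →
      500000 < W.conductorNorm ℤ →
      (∀ n : ℕ, W.kodairaSymbolAt ((Rat.HeightOneSpectrum.primesEquiv (R := ℤ)).symm ⟨p, hp⟩) ≠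
        .Istar n) →
      ¬ Summit.BirchSwinnertonDyer.Rank1Residual.Additive.TypeGOrd W p →
      padicValInt p W.minimalDiscriminantInt ≤ 4 := by
  sorry

/-- v7 STUB II5-CORNER — now a THEOREM modulo `stub_optimalUnstarredNonGord57` (law (U)), by the lead's
`cornerTypeIIAtFive_of_optimalUnstarredNonGord` (μ, gen 4): the «starred twin» corner of the Kodaira-II cell at 5 (the
starred optimal twin `W₀ ∼ W ⊗ 5` would be of type IV*, `e = 3 ∤ 4`, not (G), and (U) forbids it). Kept under its v7
statement (hypothesis `hB` of p622240, verbatim). [cite: Stevens1989, §2] [cite: SilvermanATAEC1994, IV Table 4.1] -/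
theorem typeIIAtFiveCorner_of_unstarredLaw :
    mazur_not_dvd_maninConstant_of_odd → abbesUllmo_not_dvd_maninConstant_of_not_dvd_level →
    cesnavicius_not_two_dvd_maninConstant_of_two_dvd_level → exists_isNewformOf →
    ∀ (W : WeierstrassCurve ℚ) [W.IsElliptic] [W.IsGloballyMinimal] [NeZero (W.conductorNorm ℤ)]
      (D : ModularParametrizationData W (W.conductorNorm ℤ)),
      IsLatticeOptimal D → ∀ (p : ℕ) (hp : p.Prime), (p = 5 ∨ p = 7) → p ^ 2 ∣ W.conductorNorm ℤ →
      ¬ (∃ (W' : WeierstrassCurve ℚ) (q : ℕ), W'.IsElliptic ∧ W'.IsGloballyMinimal ∧ q.Prime ∧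
          q ≠ 2 ∧ q ^ 2 ∣ W.conductorNorm ℤ ∧
          IsIsogenous W (W'.quadraticTwist (((-1 : ℤ) ^ (q / 2) * q : ℤ) : ℚ)) ∧
          ¬ q ^ 2 ∣ W'.conductorNorm ℤ) →
      ¬ (∃ (W' : WeierstrassCurve ℚ) (d : ℤ), W'.IsElliptic ∧ W'.IsGloballyMinimal ∧
          (d = -1 ∨ d = 2 ∨ d = -2) ∧ 2 ^ 2 ∣ W.conductorNorm ℤ ∧
          IsIsogenous W (W'.quadraticTwist (d : ℚ)) ∧ ¬ 2 ^ 2 ∣ W'.conductorNorm ℤ) →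
      ¬ W.HasIrreducibleModPGaloisRep p →
      500000 < W.conductorNorm ℤ →
      p ∣ D.modularDegree →
      (∀ n : ℕ, W.kodairaSymbolAt ((Rat.HeightOneSpectrum.primesEquiv (R := ℤ)).symm ⟨p, hp⟩) ≠
        .Istar n) →
      padicValInt p W.minimalDiscriminantInt ≤ 4 →
      p = 5 → padicValInt p W.minimalDiscriminantInt = 2 →
      (∀ (W₀ : WeierstrassCurve ℚ) [W₀.IsElliptic] [W₀.IsGloballyMinimal] [NeZero (W₀.conductorNorm ℤ)]
          (D₀ : ModularParametrizationData W₀ (W₀.conductorNorm ℤ)), IsLatticeOptimal D₀ →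
          IsIsogenous (W.quadraticTwist ((((-1 : ℤ) ^ (p / 2) * p : ℤ)) : ℚ)) W₀ →
          4 < padicValInt p W₀.minimalDiscriminantInt) →
      ¬ (p : ℤ) ∣ D.maninConstant :=
  cornerTypeIIAtFive_of_optimalUnstarredNonGord stub_optimalUnstarredNonGord57

/-- v6 STUB R57-LOW — now a THEOREM modulo `red57unstarredOffIIAtFive_of_cells` (v9), `typeIIAtFiveCorner_of_unstarredLaw` (v8) and ČNS
(conjunct 2 of `stub_printedInputs`): RED(57♯) on the unstarred side (hypothesis `hlow` of p617914, verbatim),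
by the lead's `coreRED57unstarred_of_cns_of_offTypeIIAtFive_of_typeIIAtFiveCorner` (gen 4). Kept under its v6
statement for the composition. [cite: Stevens1989, Lemmas (5.2), (5.4)] [cite: CesnaviciusNeururerSaha2023, Thm. 1.2] -/
theorem red57unstarred_of_flipTwin :
    mazur_not_dvd_maninConstant_of_odd → abbesUllmo_not_dvd_maninConstant_of_not_dvd_level →
    cesnavicius_not_two_dvd_maninConstant_of_two_dvd_level → exists_isNewformOf →
    ∀ (W : WeierstrassCurve ℚ) [W.IsElliptic] [W.IsGloballyMinimal] [NeZero (W.conductorNorm ℤ)]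
      (D : ModularParametrizationData W (W.conductorNorm ℤ)),
      IsLatticeOptimal D → ∀ (p : ℕ) (hp : p.Prime), (p = 5 ∨ p = 7) → p ^ 2 ∣ W.conductorNorm ℤ →
      ¬ (∃ (W' : WeierstrassCurve ℚ) (q : ℕ), W'.IsElliptic ∧ W'.IsGloballyMinimal ∧ q.Prime ∧
          q ≠ 2 ∧ q ^ 2 ∣ W.conductorNorm ℤ ∧
          IsIsogenous W (W'.quadraticTwist (((-1 : ℤ) ^ (q / 2) * q : ℤ) : ℚ)) ∧
          ¬ q ^ 2 ∣ W'.conductorNorm ℤ) →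
      ¬ (∃ (W' : WeierstrassCurve ℚ) (d : ℤ), W'.IsElliptic ∧ W'.IsGloballyMinimal ∧
          (d = -1 ∨ d = 2 ∨ d = -2) ∧ 2 ^ 2 ∣ W.conductorNorm ℤ ∧
          IsIsogenous W (W'.quadraticTwist (d : ℚ)) ∧ ¬ 2 ^ 2 ∣ W'.conductorNorm ℤ) →
      ¬ W.HasIrreducibleModPGaloisRep p →
      500000 < W.conductorNorm ℤ →
      p ∣ D.modularDegree →
      (∀ n : ℕ, W.kodairaSymbolAt ((Rat.HeightOneSpectrum.primesEquiv (R := ℤ)).symm ⟨p, hp⟩) ≠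
        .Istar n) →
      padicValInt p W.minimalDiscriminantInt ≤ 4 →
      ¬ (p : ℤ) ∣ D.maninConstant :=
  coreRED57unstarred_of_cns_of_offTypeIIAtFive_of_typeIIAtFiveCorner stub_printedInputs.2.1
    red57unstarredOffIIAtFive_of_cells typeIIAtFiveCorner_of_unstarredLaw

/-- v6/v7 STUB R57-BISTAR — now a THEOREM modulo D–D 2015 (conjunct 7 of `stub_printedInputs`) and
`stub_optimalUnstarredNonGord57` (law (U)), by the width seat's `red57bistarred_of_dokchitser_of_optimalUnstarredNonGord`
(p621355 §3; its `hU` carries an idle `p ∣ deg φ` binder, supplied by weakening (U)): the «bi-starred orbit» corner at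
`p ∈ {5, 7}` (starred `W` all of whose lattice-optimal `χ_{p*}`-partners are starred; (G)-ordinary half empty by
D–D Thm. 5.1 (1), potentially supersingular half empty by (U)). Kept under its v6 statement (hypothesis `hB` of p617914,
verbatim). [cite: DokchitserDokchitser2015LocalInvariants, Thm. 5.1 (1)] [cite: Stevens1989, §2] -/
theorem red57bistarred_of_dokchitser_of_unstarredLaw :
    mazur_not_dvd_maninConstant_of_odd → abbesUllmo_not_dvd_maninConstant_of_not_dvd_level →
    cesnavicius_not_two_dvd_maninConstant_of_two_dvd_level → exists_isNewformOf →
    ∀ (W : WeierstrassCurve ℚ) [W.IsElliptic] [W.IsGloballyMinimal] [NeZero (W.conductorNorm ℤ)]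
      (D : ModularParametrizationData W (W.conductorNorm ℤ)),
      IsLatticeOptimal D → ∀ (p : ℕ) (hp : p.Prime), (p = 5 ∨ p = 7) → p ^ 2 ∣ W.conductorNorm ℤ →
      ¬ (∃ (W' : WeierstrassCurve ℚ) (q : ℕ), W'.IsElliptic ∧ W'.IsGloballyMinimal ∧ q.Prime ∧
          q ≠ 2 ∧ q ^ 2 ∣ W.conductorNorm ℤ ∧
          IsIsogenous W (W'.quadraticTwist (((-1 : ℤ) ^ (q / 2) * q : ℤ) : ℚ)) ∧
          ¬ q ^ 2 ∣ W'.conductorNorm ℤ) →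
      ¬ (∃ (W' : WeierstrassCurve ℚ) (d : ℤ), W'.IsElliptic ∧ W'.IsGloballyMinimal ∧
          (d = -1 ∨ d = 2 ∨ d = -2) ∧ 2 ^ 2 ∣ W.conductorNorm ℤ ∧
          IsIsogenous W (W'.quadraticTwist (d : ℚ)) ∧ ¬ 2 ^ 2 ∣ W'.conductorNorm ℤ) →
      ¬ W.HasIrreducibleModPGaloisRep p →
      500000 < W.conductorNorm ℤ →
      p ∣ D.modularDegree →
      (∀ n : ℕ, W.kodairaSymbolAt ((Rat.HeightOneSpectrum.primesEquiv (R := ℤ)).symm ⟨p, hp⟩) ≠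
        .Istar n) →
      4 < padicValInt p W.minimalDiscriminantInt →
      (∀ (W₀ : WeierstrassCurve ℚ) [W₀.IsElliptic] [W₀.IsGloballyMinimal] [NeZero (W₀.conductorNorm ℤ)]
          (D₀ : ModularParametrizationData W₀ (W₀.conductorNorm ℤ)), IsLatticeOptimal D₀ →
          IsIsogenous (W.quadraticTwist ((((-1 : ℤ) ^ (p / 2) * p : ℤ)) : ℚ)) W₀ →
          4 < padicValInt p W₀.minimalDiscriminantInt) →
      ¬ (p : ℤ) ∣ D.maninConstant :=
  red57bistarred_of_dokchitser_of_optimalUnstarredNonGord stub_printedInputs.2.2.2.2.2.2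
    (fun hnf W _ _ _ D hD p hp h57 hpN hodd hdy hred hN _hdeg hI hG ↦
      stub_optimalUnstarredNonGord57 hnf W D hD p hp h57 hpN hodd hdy hred hN hI hG)

/-- v4/v5 STUB R57♯ — now a THEOREM modulo `red57unstarred_of_flipTwin` (v7), `red57bistarred_of_dokchitser_of_unstarredLaw` (v8) and ČNS (conjunct 2 of
`stub_printedInputs`): the `W[p]`-reducible residue RED(57♯) at `p ∈ {5, 7}` (hypothesis `h57s` of
`coreRED57_of_cns_cremona_of_coreRED57sharp`, p612504, verbatim), by the width seat's
`coreRED57sharp_of_cns_of_unstarred_of_bistarred` (p617914). Kept under its v4 statement for the composition.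
[cite: EdixhovenManin1991, Thm. 3] [cite: CesnaviciusNeururerSaha2023, Thm. 1.2] -/
theorem red57sharp_of_split :
    mazur_not_dvd_maninConstant_of_odd → abbesUllmo_not_dvd_maninConstant_of_not_dvd_level →
    cesnavicius_not_two_dvd_maninConstant_of_two_dvd_level → exists_isNewformOf →
    ∀ (W : WeierstrassCurve ℚ) [W.IsElliptic] [W.IsGloballyMinimal] [NeZero (W.conductorNorm ℤ)]
      (D : ModularParametrizationData W (W.conductorNorm ℤ)),
      IsLatticeOptimal D → ∀ (p : ℕ) (hp : p.Prime), (p = 5 ∨ p = 7) → p ^ 2 ∣ W.conductorNorm ℤ →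
      ¬ (∃ (W' : WeierstrassCurve ℚ) (q : ℕ), W'.IsElliptic ∧ W'.IsGloballyMinimal ∧ q.Prime ∧
          q ≠ 2 ∧ q ^ 2 ∣ W.conductorNorm ℤ ∧
          IsIsogenous W (W'.quadraticTwist (((-1 : ℤ) ^ (q / 2) * q : ℤ) : ℚ)) ∧
          ¬ q ^ 2 ∣ W'.conductorNorm ℤ) →
      ¬ (∃ (W' : WeierstrassCurve ℚ) (d : ℤ), W'.IsElliptic ∧ W'.IsGloballyMinimal ∧
          (d = -1 ∨ d = 2 ∨ d = -2) ∧ 2 ^ 2 ∣ W.conductorNorm ℤ ∧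
          IsIsogenous W (W'.quadraticTwist (d : ℚ)) ∧ ¬ 2 ^ 2 ∣ W'.conductorNorm ℤ) →
      ¬ W.HasIrreducibleModPGaloisRep p →
      500000 < W.conductorNorm ℤ →
      p ∣ D.modularDegree →
      (∀ n : ℕ, W.kodairaSymbolAt ((Rat.HeightOneSpectrum.primesEquiv (R := ℤ)).symm ⟨p, hp⟩) ≠
        .Istar n) →
      ¬ (p : ℤ) ∣ D.maninConstant :=
  coreRED57sharp_of_cns_of_unstarred_of_bistarred stub_printedInputs.2.1 red57unstarred_of_flipTwin
    red57bistarred_of_dokchitser_of_unstarredLaw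

/-- STUB DEG13 — **the Manin-free degree law on the `W[13]`-reducible unstarred locus** (hypothesis `hUp` of
the lead's `coreRED13sharp_of_edixhovenKodairaFact_of_degreeUp13Red`, p618203, VERBATIM): for `W` globally minimal
with a lattice-optimal conductor-level datum `D`, `13² ∣ N(W)`, globally twist-minimal, `W[13]` reducible
(`X₀(13)` family), `ord₁₃ Δ_min(W) ≤ 4` (Kodaira II/III/IV), (G)-ordinary (idle: automatic at `13 ≡ 1 mod 12`),
`13 ∣ deg(D)`, `N(W) > 5·10⁵`, and every globally minimal `W′` with a lattice-optimal conductor-level datum `D′`,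
`N(W′) = N(W)`, `W ⊗ 13 ∼ W′`: `deg(D′) = 13 · deg(D)` (the optimal degree goes UP along the twist, never down
(Edixhoven's case 1) and never sideways (flip)). OPEN; on commuting orbits equivalent to Manin's `13 ∤ c(D)`
granted Edixhoven's Kodaira statement. [cite: EdixhovenManin1991, Thm. 3 and §4] [cite: ZagierCMB1985, §1] -/
theorem stub_degreeUp13Red :
    exists_isNewformOf →
    ∀ (W : WeierstrassCurve ℚ) [W.IsElliptic] [W.IsGloballyMinimal] [NeZero (W.conductorNorm ℤ)]
      (D : ModularParametrizationData W (W.conductorNorm ℤ)),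
      IsLatticeOptimal D → ∀ p : ℕ, p.Prime → p = 13 → p ^ 2 ∣ W.conductorNorm ℤ →
      ¬ (∃ (W' : WeierstrassCurve ℚ) (q : ℕ), W'.IsElliptic ∧ W'.IsGloballyMinimal ∧ q.Prime ∧
          q ≠ 2 ∧ q ^ 2 ∣ W.conductorNorm ℤ ∧
          IsIsogenous W (W'.quadraticTwist (((-1 : ℤ) ^ (q / 2) * q : ℤ) : ℚ)) ∧
          ¬ q ^ 2 ∣ W'.conductorNorm ℤ) →
      ¬ (∃ (W' : WeierstrassCurve ℚ) (d : ℤ), W'.IsElliptic ∧ W'.IsGloballyMinimal ∧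
          (d = -1 ∨ d = 2 ∨ d = -2) ∧ 2 ^ 2 ∣ W.conductorNorm ℤ ∧
          IsIsogenous W (W'.quadraticTwist (d : ℚ)) ∧ ¬ 2 ^ 2 ∣ W'.conductorNorm ℤ) →
      ¬ W.HasIrreducibleModPGaloisRep p →
      padicValInt p W.minimalDiscriminantInt ≤ 4 →
      (∃ (L : Type) (_ : Field L) (_ : NumberField L) (_ : IsCyclotomicExtension {p} ℚ L)
          (F : IntermediateField ℚ L),
          ∀ w : HeightOneSpectrum (𝓞 F), (p : 𝓞 F) ∈ w.asIdeal →
            (W.baseChange F).HasGoodReductionAt w ∧ (W.baseChange F).HasUnitRootAt w) →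
      p ∣ D.modularDegree →
      500000 < W.conductorNorm ℤ →
      ∀ (W' : WeierstrassCurve ℚ) [W'.IsElliptic] [W'.IsGloballyMinimal] [NeZero (W'.conductorNorm ℤ)]
        (D' : ModularParametrizationData W' (W'.conductorNorm ℤ)),
        IsLatticeOptimal D' → W'.conductorNorm ℤ = W.conductorNorm ℤ →
        IsIsogenous (W.quadraticTwist (((-1 : ℤ) ^ (p / 2) * p : ℤ) : ℚ)) W' →
        D'.modularDegree = p * D.modularDegree := by
  sorry

/-- v4 STUB R13♯ — now a THEOREM modulo `stub_degreeUp13Red` and EdK (conjunct 4 of `stub_printedInputs`):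
the `W[13]`-reducible residue RED(13♯) (hypothesis `h13s` of `coreRED13_of_cremona_of_coreRED13sharp`, p614544,
verbatim), by the lead's `coreRED13sharp_of_edixhovenKodairaFact_of_degreeUp13Red` (p618203). Kept under its v4
statement for the record and for the composition. [cite: EdixhovenManin1991, Thm. 3 and §4] -/
theorem red13sharp_of_degreeUp13Red :
    mazur_not_dvd_maninConstant_of_odd → abbesUllmo_not_dvd_maninConstant_of_not_dvd_level →
    cesnavicius_not_two_dvd_maninConstant_of_two_dvd_level → exists_isNewformOf →
    ∀ (W : WeierstrassCurve ℚ) [W.IsElliptic] [W.IsGloballyMinimal] [NeZero (W.conductorNorm ℤ)]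
      (D : ModularParametrizationData W (W.conductorNorm ℤ)),
      IsLatticeOptimal D → ∀ p : ℕ, p.Prime → p = 13 → p ^ 2 ∣ W.conductorNorm ℤ →
      ¬ (∃ (W' : WeierstrassCurve ℚ) (q : ℕ), W'.IsElliptic ∧ W'.IsGloballyMinimal ∧ q.Prime ∧
          q ≠ 2 ∧ q ^ 2 ∣ W.conductorNorm ℤ ∧
          IsIsogenous W (W'.quadraticTwist (((-1 : ℤ) ^ (q / 2) * q : ℤ) : ℚ)) ∧
          ¬ q ^ 2 ∣ W'.conductorNorm ℤ) →
      ¬ (∃ (W' : WeierstrassCurve ℚ) (d : ℤ), W'.IsElliptic ∧ W'.IsGloballyMinimal ∧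
          (d = -1 ∨ d = 2 ∨ d = -2) ∧ 2 ^ 2 ∣ W.conductorNorm ℤ ∧
          IsIsogenous W (W'.quadraticTwist (d : ℚ)) ∧ ¬ 2 ^ 2 ∣ W'.conductorNorm ℤ) →
      ¬ W.HasIrreducibleModPGaloisRep p →
      padicValInt p W.minimalDiscriminantInt ≤ 4 →
      (∃ (L : Type) (_ : Field L) (_ : NumberField L) (_ : IsCyclotomicExtension {p} ℚ L)
          (F : IntermediateField ℚ L),
          ∀ w : HeightOneSpectrum (𝓞 F), (p : 𝓞 F) ∈ w.asIdeal →
            (W.baseChange F).HasGoodReductionAt w ∧ (W.baseChange F).HasUnitRootAt w) →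
      p ∣ D.modularDegree →
      500000 < W.conductorNorm ℤ →
      ¬ (p : ℤ) ∣ D.maninConstant :=
  coreRED13sharp_of_edixhovenKodairaFact_of_degreeUp13Red stub_printedInputs.2.2.2.1 stub_degreeUp13Red

/-- COMPOSITION (sorry-free): the five v8 stubs prove crux C5 `ManinPrimeToAdditiveFiveLe` BY NAME — the width
seat's ledger `maninPrimeToAdditiveFiveLe_of_kato57_print_of_kp57_of_reducibleCores` (p611587) fed with
`coreRED57_of_cns_cremona_of_coreRED57sharp` (p612504) over the θ split (`red57sharp_of_split`, via p617914),
`coreRED11_of_mazurJ_of_coreRED13` (p612408),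
`coreRED13_of_cremona_of_coreRED13sharp` (p614544) and RED(13♯) from the degree law (`red13sharp_of_degreeUp13Red`,
via p618203). -/
theorem ManinPrimeToAdditiveFiveLe_of :
    Summit.BirchSwinnertonDyer.BirchSwinnertonDyer.Theses.ManinLocalTwoThree.ManinPrimeToAdditiveFiveLe :=
  maninPrimeToAdditiveFiveLe_of_kato57_print_of_kp57_of_reducibleCores
    stub_printedInputs.1 stub_printedInputs.2.1 stub_printedInputs.2.2.1 stub_printedInputs.2.2.2.1
    stub_printedInputs.2.2.2.2.1 stub_kp57
    (coreRED57_of_cns_cremona_of_coreRED57sharp stub_printedInputs.2.1 stub_printedInputs.2.2.1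
      red57sharp_of_split)
    (coreRED11_of_mazurJ_of_coreRED13 stub_printedInputs.2.2.2.2.2.1
      (coreRED13_of_cremona_of_coreRED13sharp stub_printedInputs.2.2.1 red13sharp_of_degreeUp13Red))

end Summit.BirchSwinnertonDyer.BirchSwinnertonDyer.Cruxes.ManinPrimeToAdditiveFiveLe.EtaleEisenstein

end
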